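/-
Copyright (c) 2026 the pub-hodgecm-mathlib formalisation cell (harness21).  Prover seat hodgecm-mathlib-LH4-p08 (g10), req620 Track A «(D-RAM) FOUR-FRAME» squad, helper lane
on h413 = stmt-HodgeConjecture-24833 (count-neutral).  β sub-dealer LH4-p05 (g8) LEDGER #12∕#13: ROW R6 «SPECIAL κ-CLASSES», tower 3 — B4 §4: the orbit sum and the
per-stratum value of a tower-3 κ-class below the read (R6-DERIVATION v2 0628fb8c §4∕§5).  2026-09-04.
-/
import Summits.HodgeConjecture.HodgeConjecture.Theorems.F0P3cDyRamLabelledOddKappaClassRepFootG3        -- ★ p862059 (this seat): §1 the κ-locus filter, §3 the per-rep value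
import Summits.HodgeConjecture.HodgeConjecture.Theorems.F0P3cDyRamLabelledOddKappaClassIndicatorTwoG3   -- ★ p862219 (this seat): the three indicators in closed form
import Summits.HodgeConjecture.HodgeConjecture.Theorems.F0P3cDyRamDiagonalKappaGluedDecomposition       -- ★ (LH4-p14): `orbit_mass_eq_pow`
import Summits.HodgeConjecture.HodgeConjecture.Theorems.F0P3cDyRamDiagonalGluedClassRepresentatives      -- ★ (LH4-p14): `exists_fixed_class_representatives`
import Summits.HodgeConjecture.HodgeConjecture.Theorems.F0P3cDyRamValueClassLabelEquivariant             -- ★ (LH7-p05): `isTorusEquivariantLabel_valueClassLabel`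
import HarnessLib

/-!
# Crux `H413`, line LH4 «(D-RAM) FOUR-FRAME» — (β) Stage B, β-BOARD row R6 (tower 3): THE VALUE OF A TOWER-3 κ-CLASS STRATUM BELOW THE READ —
# `Σᶠ_{stratum (2ρ+2t, 2ρ+2t, 2ρ) ∧ shell} m^Λ_i∕[𝒰:N′] = (0, 0, ω(−1)ω(e_B)∕2 · q^{2ρ+t−1} · ((q−1)[d ≤ t′] − [t′+1 = d]))_i`, `t′ = k₃ − ρ − t`

Cell `hodgecm-mathlib` (D-0151), FLOOR 0, crux item H413 = `stmt-HodgeConjecture-24833`, route `HCCMUnconditional`; squad F0∕P3c∕LH4.  THEOREMS ONLY (no `def`, no instance, no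
notation, no `sorry`, default heartbeats); ★-only imports; lane `--supports stmt-HodgeConjecture-24833 --as helper` (count-neutral); pays NO row, states NO law.

WHAT.  On the κ-LOCUS `2ρ + ℓ₀ = n₁ = n₂` below the read (`2ρ + 2t < 2k₃`, `2k₃ + ℓ₀ = n₃`), for `d ≤ ρ`:
* §1 `labelledOddCount_div_relIndex_latt_G3_rep_foot_closed` — ★ p862059 §3 with its three indicators CLOSED by ★ p862219 (`𝟙₀ = 𝟙₁ = [2d−1 ≤ ρ]`, `𝟙₂ = [2d ≤ ρ+2t′+1]`):
  the per-representative value of LH4-p18 (g0)'s `M(g)` is `ω(e_B)ω(1−κ′)·(ω(g)ω(1+g)ω(1+κ″∕g)·𝟙₀, ω(−1)ω(g)ω(1+κ″∕g)·𝟙₁, ω(−1)ω(1+κ″∕g)·𝟙₂)_i ∕ 2 · w`.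
* §2 `sum_repr_labelledOddCount_div_relIndex_latt_G3_rep_foot` — summed over any index set `R` of level-`2t` fixed elements: the `g`-dependence sits in the three character sums
  `Σ_R ω(g)ω(1+g)ω(1+κ″∕g)`, `Σ_R ω(g)ω(1+κ″∕g)`, `Σ_R ω(1+κ″∕g)` (pure bookkeeping).
* §3 `finsum_stratum_G3_kappaLocus_shell_labelledOdd_div_relIndex_eq_of_lt_read` — THE STRATUM VALUE: ★ p862059 §1 (the filter is everything) ∘ §2 on ★
  `exists_fixed_class_representatives` (`#R = (q−1)q^{⌈ρ∕2⌉−1}`) ∘ ★ p861882's foot sums with `κ := κ″` (`|κ″| = |ϖ|^{2t}·|ϖ|^{2t′}`): slots 0∕1 vanish (the twisted sums,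
  `2d ≤ ρ+1` when the indicator is on), slot 2 is `#R ∕ −q^{⌈ρ∕2⌉−1} ∕ 0` in the regimes `d ≤ t′ ∕ t′+1 = d ∕ t′+2 ≤ d` (the last one: the window sum vanishes or `𝟙₂ = 0`),
  `ω(1−κ′) = 1` whenever the answer is non-zero (`2t + 2t′ ≥ 2d − 1`), and ★ `orbit_mass_eq_pow`: `|orbit|·w·q^{⌈ρ∕2⌉−1} = q^{2ρ+t−1}`.
This is R6-DERIVATION v2 §4's per-class value `κ₃(ρ, 2t)`; the s-line∕head in F0P3a-p01 (g37)'s `hR6₃` letters is the (optional, LEDGER #18) cross-check sequel.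
HONEST LABEL.  Count-neutral; the κ-row∕hRest∕(β-BAL)∕(β)∕T₊ remain OPEN; `HC_CM` is proved only modulo the 7 printed citations (2 remaining named inputs: hLiu418 =
`stmt-HodgeConjecture-24832`, h413 = `stmt-HodgeConjecture-24833`) until rung 0 closes.

## References
* [Kottwitz1986BaseChangeUnits] R. E. Kottwitz, *Base change for unit elements of Hecke algebras*, Compositio Math. 60 (1986), §1 pp. 240–241 (signed lattice counts by torus orbits).
* [LanglandsShelstad1987] R. P. Langlands, D. Shelstad, *On the definition of transfer factors*, Math. Ann. 278 (1987), §3 (κ-signs as characters).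
* [Rogawski1990] J. D. Rogawski, *Automorphic Representations of Unitary Groups in Three Variables*, Ann. of Math. Stud. 123 (1990), §4.9 Prop. 4.9.1 (a)(b) p. 55, §4.10 p. 58.
* [Serre1979] J.-P. Serre, *Local Fields*, GTM 67 (1979), Ch. V §3 Cor. 3, Ch. XV §2 (norm residue symbol of a ramified quadratic extension).
-/

set_option autoImplicit false

noncomputable section

namespace Summit.HodgeConjecture.HodgeConjecture.Cruxes.H413.F0P3cDyRamLabelledOddKappaClassSumG3

open Literature.NumberTheory.Automorphic Literature.NumberTheory.Automorphic.HermitianLattice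
open Literature.NumberTheory.Automorphic.UnitaryLatticeTree Literature.NumberTheory.Automorphic.UnitaryThreeFourFrame
open Literature.NumberTheory.LocalFields Literature.NumberTheory.LocalFields.WildQuadraticDatum
open Summit.HodgeConjecture.HodgeConjecture.Cruxes.H413.F0P3cDyRamFourFramePieces
open Summit.HodgeConjecture.HodgeConjecture.Cruxes.H413.F0P3cDyRamFourFrameCensusDefs
open Summit.HodgeConjecture.HodgeConjecture.Cruxes.H413.F0P3cDyRamStageOneBDefs (mcOfRecord)
open Summit.HodgeConjecture.HodgeConjecture.Cruxes.H413.F0P3cDyRamDiagonalTorusDefs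
open Summit.HodgeConjecture.HodgeConjecture.Cruxes.H413.F0P3cDyRamDiagonalStrataDefs
open Summit.HodgeConjecture.HodgeConjecture.Cruxes.H413.F0P3cDyRamLabelledOddCountDefs
open Summit.HodgeConjecture.HodgeConjecture.Cruxes.H413.F0P3cDyRamLabelledOddKappaClassRepFootG3
open Summit.HodgeConjecture.HodgeConjecture.Cruxes.H413.F0P3cDyRamLabelledOddKappaClassIndicatorTwoG3 (indicators_latt_G3_rep_foot)
open Summit.HodgeConjecture.HodgeConjecture.Cruxes.H413.F0P3cDyRamKappaClassFootSums
open Summit.HodgeConjecture.HodgeConjecture.Cruxes.H413.F0P3cDyRamDiagonalKappaGluedDecomposition (orbit_mass_eq_pow)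
open Summit.HodgeConjecture.HodgeConjecture.Cruxes.H413.F0P3cDyRamDiagonalGluedClassRepresentatives (exists_fixed_class_representatives)
open Summit.HodgeConjecture.HodgeConjecture.Cruxes.H413.F0P3cDyRamValueClassLabelEquivariant (isTorusEquivariantLabel_valueClassLabel)
open scoped Valued WithZero Matrix MatrixGroups

variable {K : Type} [Field K] [Valued K ℤᵐ⁰] [CompleteSpace K] [Fintype 𝓀[K]] {σ : K →+* K} {ϖ : K} {d t₂ : ℕ} {α β : K} {N₀ n₁ n₂ n₃ : ℕ}

/-! ## §1  The per-representative value with the indicators closed -/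

open Classical in
/-- **THE PER-REPRESENTATIVE VALUE OF THE κ-CLASS AT THE FOOT, INDICATORS CLOSED** (★ p862059 §3 ∘ ★ p862219 §3; `d ≤ ρ`):
`value_i(M(g)) = ω(e_B)ω(1−κ′)·(ω(g)ω(1+g)ω(1+κ″∕g)·[2d−1 ≤ ρ], ω(−1)ω(g)ω(1+κ″∕g)·[2d−1 ≤ ρ], ω(−1)ω(1+κ″∕g)·[2d ≤ ρ + 2(k₃−ρ−t) + 1])_i ∕ 2 · w`.
[cite: Kottwitz1986BaseChangeUnits, §1 pp. 240–241] [cite: LanglandsShelstad1987, §3] [cite: Serre1979, Ch. V §3 Cor. 3; Ch. XV §2] -/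
theorem labelledOddCount_div_relIndex_latt_G3_rep_foot_closed (hD : IsRamifiedQuadraticDatum σ ϖ d t₂) (h2 : Valued.v (2 : K) < 1) (h2d : 2 ≤ d)
    (hE : IsElementDatum σ ϖ N₀ α β n₁ n₂ n₃) (hmc : mcOfRecord d ≤ N₀)
    (T : GL (Fin 3) K) (hT : (T : Matrix (Fin 3) (Fin 3) K) = Matrix.diagonal ![α, β, 1])
    {ρ t : ℕ} (hρ : 1 ≤ ρ) (ht : 1 ≤ t) (hdρ : d ≤ ρ) (hκ : 2 * ρ + d % 2 = n₂) (h12 : n₁ = n₂)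
    (k₃ : ℕ) (hlt : 2 * ρ + 2 * t < 2 * k₃) (hk₃ : 2 * k₃ + d % 2 = n₃)
    {g : K} (hσg : σ g = g) (hg : Valued.v g = Valued.v ϖ ^ (2 * t))
    {eC : K} (hσeC : σ eC = eC) (heC1 : Valued.v eC = 1)
    (heC : Valued.v ((ϖ ^ (d % 2 + 2 * d - 1))⁻¹ * ((β - α) * ((ϖ * σ ϖ) ^ k₃)⁻¹ - eC * ((ϖ - σ ϖ) * ((ϖ * σ ϖ) ^ ((d - d % 2) / 2))⁻¹))) ≤ 1)
    {eB : K} (hσeB : σ eB = eB) (heB1 : Valued.v eB = 1)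
    (heB : Valued.v ((ϖ ^ (d % 2 + 2 * d - 1))⁻¹ * ((β - 1) * ((ϖ * σ ϖ) ^ ρ)⁻¹ - eB * ((ϖ - σ ϖ) * ((ϖ * σ ϖ) ^ ((d - d % 2) / 2))⁻¹))) ≤ 1) (i : Fin 3) :
    (labelledOddCount σ ϖ 0 i (valueClassLabel σ ϖ (α - 1) (β - 1) (mstarOfRecord d) d)
          (latt (!![1, 0, 0; (1 + g)⁻¹, ϖ ^ (ρ + 2 * t), 0; (1 + g)⁻¹, -(ϖ ^ (ρ + 2 * t) * g⁻¹), ϖ ^ (2 * ρ)] : Matrix (Fin 3) (Fin 3) K)) : ℚ) /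
        ((((unitStabilizer (latt (!![1, 0, 0; (1 + g)⁻¹, ϖ ^ (ρ + 2 * t), 0; (1 + g)⁻¹, -(ϖ ^ (ρ + 2 * t) * g⁻¹), ϖ ^ (2 * ρ)] : Matrix (Fin 3) (Fin 3) K))).map
            (unitNormMap σ 3)).relIndex (fixedUnitTorus σ 3) : ℕ) : ℚ) =
      ((normSign σ eB * normSign σ (1 - eC * (ϖ * σ ϖ) ^ k₃ / (eB * (ϖ * σ ϖ) ^ ρ)) : ℤ) : ℚ) *
        ((![normSign σ g * normSign σ (1 + g) *
              normSign σ (1 + -(eC * (ϖ * σ ϖ) ^ k₃ / (eB * (ϖ * σ ϖ) ^ ρ)) / (1 - eC * (ϖ * σ ϖ) ^ k₃ / (eB * (ϖ * σ ϖ) ^ ρ)) / g) *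
              (if 2 * d - 1 ≤ ρ then 1 else 0),
            normSign σ (-1) * (normSign σ g *
              normSign σ (1 + -(eC * (ϖ * σ ϖ) ^ k₃ / (eB * (ϖ * σ ϖ) ^ ρ)) / (1 - eC * (ϖ * σ ϖ) ^ k₃ / (eB * (ϖ * σ ϖ) ^ ρ)) / g)) *
              (if 2 * d - 1 ≤ ρ then 1 else 0),
            normSign σ (-1) * normSign σ (1 + -(eC * (ϖ * σ ϖ) ^ k₃ / (eB * (ϖ * σ ϖ) ^ ρ)) / (1 - eC * (ϖ * σ ϖ) ^ k₃ / (eB * (ϖ * σ ϖ) ^ ρ)) / g) *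
              (if 2 * d ≤ ρ + 2 * (k₃ - ρ - t) + 1 then 1 else 0)] : Fin 3 → ℤ) i : ℚ) / 2 *
        ((((Nat.card 𝓀[K] - 1) * Nat.card 𝓀[K] ^ ((ρ + 2 * t + 1) / 2 - 1)) * ((Nat.card 𝓀[K] - 1) * Nat.card 𝓀[K] ^ (ρ - 1)) : ℕ) : ℚ)⁻¹ := by
  have hval := labelledOddCount_div_relIndex_latt_G3_rep_foot hD h2d hE hmc T hT hρ ht hκ h12 k₃ hlt hk₃ hσg hg hσeC heC1 heC hσeB heB1 heB i
  have hind := indicators_latt_G3_rep_foot hD h2 hρ ht hdρ k₃ (by omega) hσg hg hσeC heC1 hσeB heB1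
  dsimp only at hval hind
  obtain ⟨h0, h1, h2'⟩ := hind
  rw [hval, if_congr h0 rfl rfl, if_congr h1 rfl rfl, if_congr h2' rfl rfl]

/-! ## §2  The orbit sum: the `g`-dependence sits in three character sums -/

open Classical in
/-- **THE SUM OVER THE REPRESENTATIVES** (any finite `R` of σ-fixed `g` with `|g| = |ϖ|^{2t}`): by §1,
`Σ_{g∈R} value_i(M(g)) = (ω(e_B)ω(1−κ′)·[2d−1 ≤ ρ]∕2·w · Σ_R ω(g)ω(1+g)ω(1+κ″∕g), ω(e_B)ω(1−κ′)ω(−1)·[2d−1 ≤ ρ]∕2·w · Σ_R ω(g)ω(1+κ″∕g),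
ω(e_B)ω(1−κ′)ω(−1)·[2d ≤ ρ+2(k₃−ρ−t)+1]∕2·w · Σ_R ω(1+κ″∕g))_i` (bookkeeping). [cite: Kottwitz1986BaseChangeUnits, §1 pp. 240–241] [cite: LanglandsShelstad1987, §3] -/
theorem sum_repr_labelledOddCount_div_relIndex_latt_G3_rep_foot (hD : IsRamifiedQuadraticDatum σ ϖ d t₂) (h2 : Valued.v (2 : K) < 1) (h2d : 2 ≤ d)
    (hE : IsElementDatum σ ϖ N₀ α β n₁ n₂ n₃) (hmc : mcOfRecord d ≤ N₀)
    (T : GL (Fin 3) K) (hT : (T : Matrix (Fin 3) (Fin 3) K) = Matrix.diagonal ![α, β, 1])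
    {ρ t : ℕ} (hρ : 1 ≤ ρ) (ht : 1 ≤ t) (hdρ : d ≤ ρ) (hκ : 2 * ρ + d % 2 = n₂) (h12 : n₁ = n₂)
    (k₃ : ℕ) (hlt : 2 * ρ + 2 * t < 2 * k₃) (hk₃ : 2 * k₃ + d % 2 = n₃)
    {eC : K} (hσeC : σ eC = eC) (heC1 : Valued.v eC = 1)
    (heC : Valued.v ((ϖ ^ (d % 2 + 2 * d - 1))⁻¹ * ((β - α) * ((ϖ * σ ϖ) ^ k₃)⁻¹ - eC * ((ϖ - σ ϖ) * ((ϖ * σ ϖ) ^ ((d - d % 2) / 2))⁻¹))) ≤ 1)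
    {eB : K} (hσeB : σ eB = eB) (heB1 : Valued.v eB = 1)
    (heB : Valued.v ((ϖ ^ (d % 2 + 2 * d - 1))⁻¹ * ((β - 1) * ((ϖ * σ ϖ) ^ ρ)⁻¹ - eB * ((ϖ - σ ϖ) * ((ϖ * σ ϖ) ^ ((d - d % 2) / 2))⁻¹))) ≤ 1)
    (R : Finset K) (hR1 : ∀ g ∈ R, σ g = g ∧ Valued.v g = Valued.v ϖ ^ (2 * t)) (i : Fin 3) :
    ∑ g ∈ R,
        (labelledOddCount σ ϖ 0 i (valueClassLabel σ ϖ (α - 1) (β - 1) (mstarOfRecord d) d)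
            (latt (!![1, 0, 0; (1 + g)⁻¹, ϖ ^ (ρ + 2 * t), 0; (1 + g)⁻¹, -(ϖ ^ (ρ + 2 * t) * g⁻¹), ϖ ^ (2 * ρ)] : Matrix (Fin 3) (Fin 3) K)) : ℚ) /
          ((((unitStabilizer (latt (!![1, 0, 0; (1 + g)⁻¹, ϖ ^ (ρ + 2 * t), 0; (1 + g)⁻¹, -(ϖ ^ (ρ + 2 * t) * g⁻¹), ϖ ^ (2 * ρ)] : Matrix (Fin 3) (Fin 3) K))).map
              (unitNormMap σ 3)).relIndex (fixedUnitTorus σ 3) : ℕ) : ℚ) =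
      (![((normSign σ eB * normSign σ (1 - eC * (ϖ * σ ϖ) ^ k₃ / (eB * (ϖ * σ ϖ) ^ ρ)) : ℤ) : ℚ) * (if 2 * d - 1 ≤ ρ then (1 : ℚ) else 0) / 2 *
            ((((Nat.card 𝓀[K] - 1) * Nat.card 𝓀[K] ^ ((ρ + 2 * t + 1) / 2 - 1)) * ((Nat.card 𝓀[K] - 1) * Nat.card 𝓀[K] ^ (ρ - 1)) : ℕ) : ℚ)⁻¹ *
            ((∑ g ∈ R, normSign σ g * normSign σ (1 + g) *
                normSign σ (1 + -(eC * (ϖ * σ ϖ) ^ k₃ / (eB * (ϖ * σ ϖ) ^ ρ)) / (1 - eC * (ϖ * σ ϖ) ^ k₃ / (eB * (ϖ * σ ϖ) ^ ρ)) / g) : ℤ) : ℚ),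
          ((normSign σ eB * normSign σ (1 - eC * (ϖ * σ ϖ) ^ k₃ / (eB * (ϖ * σ ϖ) ^ ρ)) * normSign σ (-1) : ℤ) : ℚ) * (if 2 * d - 1 ≤ ρ then (1 : ℚ) else 0) / 2 *
            ((((Nat.card 𝓀[K] - 1) * Nat.card 𝓀[K] ^ ((ρ + 2 * t + 1) / 2 - 1)) * ((Nat.card 𝓀[K] - 1) * Nat.card 𝓀[K] ^ (ρ - 1)) : ℕ) : ℚ)⁻¹ *
            ((∑ g ∈ R, normSign σ g *
                normSign σ (1 + -(eC * (ϖ * σ ϖ) ^ k₃ / (eB * (ϖ * σ ϖ) ^ ρ)) / (1 - eC * (ϖ * σ ϖ) ^ k₃ / (eB * (ϖ * σ ϖ) ^ ρ)) / g) : ℤ) : ℚ),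
          ((normSign σ eB * normSign σ (1 - eC * (ϖ * σ ϖ) ^ k₃ / (eB * (ϖ * σ ϖ) ^ ρ)) * normSign σ (-1) : ℤ) : ℚ) *
              (if 2 * d ≤ ρ + 2 * (k₃ - ρ - t) + 1 then (1 : ℚ) else 0) / 2 *
            ((((Nat.card 𝓀[K] - 1) * Nat.card 𝓀[K] ^ ((ρ + 2 * t + 1) / 2 - 1)) * ((Nat.card 𝓀[K] - 1) * Nat.card 𝓀[K] ^ (ρ - 1)) : ℕ) : ℚ)⁻¹ *
            ((∑ g ∈ R, normSign σ (1 + -(eC * (ϖ * σ ϖ) ^ k₃ / (eB * (ϖ * σ ϖ) ^ ρ)) / (1 - eC * (ϖ * σ ϖ) ^ k₃ / (eB * (ϖ * σ ϖ) ^ ρ)) / g) : ℤ) : ℚ)] :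
        Fin 3 → ℚ) i := by
  have h4 := fun g (hg : g ∈ R) => labelledOddCount_div_relIndex_latt_G3_rep_foot_closed hD h2 h2d hE hmc T hT hρ ht hdρ hκ h12 k₃ hlt hk₃
    (hR1 g hg).1 (hR1 g hg).2 hσeC heC1 heC hσeB heB1 heB i
  rw [Finset.sum_congr rfl h4]
  fin_cases i <;>
    simp only [Fin.zero_eta, Fin.mk_one, Fin.reduceFinMk, Fin.isValue, Matrix.cons_val_zero, Matrix.cons_val_one, Matrix.head_cons,
      Matrix.cons_val_two, Matrix.tail_cons] <;>
    rw [Int.cast_sum, Finset.mul_sum] <;> refine Finset.sum_congr rfl fun g _ => ?_ <;> push_cast <;> ring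

/-! ## §3  The stratum value below the read -/

open Classical in
/-- **THE VALUE OF A TOWER-3 κ-CLASS STRATUM BELOW THE READ** (element datum, `T = diag(α, β, 1)`, κ-locus `2ρ + ℓ₀ = n₁ = n₂`, read `2k₃ + ℓ₀ = n₃` with `ρ + t < k₃`,
`d ≤ ρ`, unit tokens `e_B` (depth `ρ`), `e_C` (depth `k₃`)): with `t′ = k₃ − ρ − t`,
`Σᶠ_{M ∈ stratum (2ρ+2t, 2ρ+2t, 2ρ) ∧ shell} m^Λ_i(M)∕[𝒰 : N(S̃(M))] = (0, 0, ω(−1)ω(e_B)∕2 · q^{2ρ+t−1} · ((q−1)·[d ≤ t′] − [t′ + 1 = d]))_i`.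
[cite: Kottwitz1986BaseChangeUnits, §1 pp. 240–241] [cite: LanglandsShelstad1987, §3] [cite: Rogawski1990, §4.9 Prop. 4.9.1 (a)(b) p. 55] [cite: Serre1979, Ch. V §3 Cor. 3; Ch. XV §2] -/
theorem finsum_stratum_G3_kappaLocus_shell_labelledOdd_div_relIndex_eq_of_lt_read (hD : IsRamifiedQuadraticDatum σ ϖ d t₂) (h2 : Valued.v (2 : K) < 1)
    (h2d : 2 ≤ d) (hE : IsElementDatum σ ϖ N₀ α β n₁ n₂ n₃) (hmc : mcOfRecord d ≤ N₀)
    (T : GL (Fin 3) K) (hT : (T : Matrix (Fin 3) (Fin 3) K) = Matrix.diagonal ![α, β, 1])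
    {ρ t : ℕ} (hρ : 1 ≤ ρ) (ht : 1 ≤ t) (hdρ : d ≤ ρ) (hκ : 2 * ρ + d % 2 = n₂) (h12 : n₁ = n₂)
    (k₃ : ℕ) (hlt : 2 * ρ + 2 * t < 2 * k₃) (hk₃ : 2 * k₃ + d % 2 = n₃)
    {eC : K} (hσeC : σ eC = eC) (heC1 : Valued.v eC = 1)
    (heC : Valued.v ((ϖ ^ (d % 2 + 2 * d - 1))⁻¹ * ((β - α) * ((ϖ * σ ϖ) ^ k₃)⁻¹ - eC * ((ϖ - σ ϖ) * ((ϖ * σ ϖ) ^ ((d - d % 2) / 2))⁻¹))) ≤ 1)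
    {eB : K} (hσeB : σ eB = eB) (heB1 : Valued.v eB = 1)
    (heB : Valued.v ((ϖ ^ (d % 2 + 2 * d - 1))⁻¹ * ((β - 1) * ((ϖ * σ ϖ) ^ ρ)⁻¹ - eB * ((ϖ - σ ϖ) * ((ϖ * σ ϖ) ^ ((d - d % 2) / 2))⁻¹))) ≤ 1) (i : Fin 3) :
    ∑ᶠ M ∈ {M : Submodule 𝒪[K] (Fin 3 → K) | M ∈ stratum σ ϖ T ![2 * ρ + 2 * t, 2 * ρ + 2 * t, 2 * ρ] ∧
        (LatticeInLevel ϖ (d % 2) (Matrix.diagonal ![α - 1, β - 1, 0]) M ∧ ¬ LatticeInLevel ϖ (d % 2 + 1) (Matrix.diagonal ![α - 1, β - 1, 0]) M ∧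
          LatticeInLevel ϖ (mcOfRecord d) (Matrix.diagonal ![(α - 1) * (α - 1), (β - 1) * (β - 1), 0]) M)},
      (labelledOddCount σ ϖ 0 i (valueClassLabel σ ϖ (α - 1) (β - 1) (mstarOfRecord d) d) M : ℚ) /
        ((((unitStabilizer M).map (unitNormMap σ 3)).relIndex (fixedUnitTorus σ 3) : ℕ) : ℚ) =
      (![(0 : ℚ), 0,
          ((normSign σ (-1 : K) : ℤ) : ℚ) * ((normSign σ eB : ℤ) : ℚ) / 2 * (Nat.card 𝓀[K] : ℚ) ^ (2 * ρ + t - 1) *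
            ((if d ≤ k₃ - ρ - t then (Nat.card 𝓀[K] : ℚ) - 1 else 0) - (if k₃ - ρ - t + 1 = d then 1 else 0))] : Fin 3 → ℚ) i := by
  obtain ⟨hσ, hvσ, hϖ, hfix, hdd, hd1, -⟩ := id hD
  haveI : Finite 𝓀[K] := Finite.of_fintype _
  have hq1 : 1 < Nat.card 𝓀[K] := Finite.one_lt_card
  have hϖ0 : ϖ ≠ 0 := fun h0 => by rw [h0, map_zero] at hϖ; exact WithZero.coe_ne_zero hϖ.symm
  have hϖ1 : Valued.v ϖ < 1 := by rw [hϖ, ← WithZero.exp_zero, WithZero.exp_lt_exp]; norm_num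
  have hvϖ : 0 < Valued.v ϖ := (Valuation.pos_iff _).2 hϖ0
  -- the representative system
  obtain ⟨R₀, hfin, hcard, hR1, hR2, hR3⟩ := exists_fixed_class_representatives hσ hvσ hfix hϖ hdd ρ t hρ
  have hmem : ∀ g, g ∈ hfin.toFinset ↔ g ∈ R₀ := fun g => Set.Finite.mem_toFinset hfin
  have hR1' : ∀ g ∈ hfin.toFinset, σ g = g ∧ Valued.v g = Valued.v ϖ ^ (2 * t) := fun g hg => hR1 g ((hmem g).1 hg)
  have hR2' : ∀ f : K, σ f = f → Valued.v f = Valued.v ϖ ^ (2 * t) → ∃ g ∈ hfin.toFinset, Valued.v (f - g) ≤ Valued.v ϖ ^ (ρ + 2 * t) :=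
    fun f hf hvf => by obtain ⟨g, hg, h⟩ := hR2 f hf hvf; exact ⟨g, (hmem g).2 hg, h⟩
  have hR3' : ∀ g ∈ hfin.toFinset, ∀ g' ∈ hfin.toFinset, Valued.v (g - g') ≤ Valued.v ϖ ^ (ρ + 2 * t) → g = g' :=
    fun g hg g' hg' h => hR3 g ((hmem g).1 hg) g' ((hmem g').1 hg') h
  have hRcard : hfin.toFinset.card = (Nat.card 𝓀[K] - 1) * Nat.card 𝓀[K] ^ ((ρ + 1) / 2 - 1) := by
    rw [← Set.ncard_eq_toFinset_card R₀ hfin]; exact hcard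
  rw [finsum_stratum_G3_shell_labelledOdd_div_relIndex_eq_card_mul_sum_of_kappaLocus hD h2 hE hmc T hT ρ t hρ ht hκ (by omega) hfin.toFinset hR1' hR2' hR3' 0 i
      (isTorusEquivariantLabel_valueClassLabel σ ϖ (α - 1) (β - 1) (mstarOfRecord d) d),
    sum_repr_labelledOddCount_div_relIndex_latt_G3_rep_foot hD h2 h2d hE hmc T hT hρ ht hdρ hκ h12 k₃ hlt hk₃ hσeC heC1 heC hσeB heB1 heB hfin.toFinset hR1' i]
  -- the letters of `κ′` and `κ″ = −κ′∕(1−κ′)`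
  set κ' : K := eC * (ϖ * σ ϖ) ^ k₃ / (eB * (ϖ * σ ϖ) ^ ρ) with hκ'def
  have hvπ : ∀ k : ℕ, Valued.v ((ϖ * σ ϖ) ^ k) = Valued.v ϖ ^ (2 * k) := fun k => by rw [map_pow, map_mul, hvσ, ← pow_two, ← pow_mul, mul_comm]
  have hπσ : ∀ k : ℕ, σ ((ϖ * σ ϖ) ^ k) = (ϖ * σ ϖ) ^ k := fun k => by rw [map_pow, map_mul, hσ, mul_comm]
  have hσκ' : σ κ' = κ' := by rw [hκ'def, map_div₀, map_mul, map_mul, hσeC, hσeB, hπσ, hπσ]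
  have hκ'v : Valued.v κ' = Valued.v ϖ ^ (2 * (k₃ - ρ)) := by
    rw [hκ'def, map_div₀, map_mul, map_mul, heC1, heB1, one_mul, one_mul, hvπ, hvπ, div_eq_iff (pow_ne_zero _ hvϖ.ne'), ← pow_add]; congr 1; omega
  have hκ'lt : Valued.v κ' < 1 := by rw [hκ'v]; exact pow_lt_one₀ zero_le hϖ1 (by omega)
  have hσκ'' : σ (-κ' / (1 - κ')) = -κ' / (1 - κ') := by rw [map_div₀, map_neg, map_sub, map_one, hσκ']
  have hκ''v : Valued.v (-κ' / (1 - κ')) = Valued.v ϖ ^ (2 * t) * Valued.v ϖ ^ (2 * (k₃ - ρ - t)) := by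
    rw [map_div₀, Valuation.map_neg, hκ'v, sub_eq_add_neg, Valued.v.map_one_add_of_lt (by rw [Valuation.map_neg]; exact hκ'lt), div_one, ← pow_add]
    congr 1; omega
  have hω1 : 2 * d - 1 ≤ 2 * (k₃ - ρ) → normSign σ (1 - κ') = 1 := fun hn =>
    normSign_eq_one_of_fixed_of_v_sub_one_le hD (by rw [map_sub, map_one, hσκ']) hn (by rw [sub_sub_cancel_left, Valuation.map_neg, hκ'v])
  -- the orbit mass
  set Wn : ℕ := ((Nat.card 𝓀[K] - 1) * Nat.card 𝓀[K] ^ ((ρ + 2 * t + 1) / 2 - 1)) * ((Nat.card 𝓀[K] - 1) * Nat.card 𝓀[K] ^ (ρ - 1)) with hWn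
  set Nn : ℕ := ((Nat.card 𝓀[K] - 1) * Nat.card 𝓀[K] ^ (ρ + 2 * t - 1)) * ((Nat.card 𝓀[K] - 1) * Nat.card 𝓀[K] ^ (2 * ρ - 1)) with hNn
  have hmass := orbit_mass_eq_pow hq1 hρ t
  have hj : (ρ + 2 * t + 1) / 2 = (ρ + 1) / 2 + t := by
    rw [show ρ + 2 * t + 1 = ρ + 1 + t * 2 by ring, Nat.add_mul_div_right _ _ (by norm_num : 0 < 2)]
  have e1 : 2 * ρ + 2 * t - (ρ + 2 * t + 1) / 2 + ((ρ + 1) / 2 - 1) = 2 * ρ + t - 1 := by rw [hj]; omega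
  have epow : (Nat.card 𝓀[K] : ℚ) ^ (2 * ρ + t - 1) =
      (Nat.card 𝓀[K] : ℚ) ^ (2 * ρ + 2 * t - (ρ + 2 * t + 1) / 2) * (Nat.card 𝓀[K] : ℚ) ^ ((ρ + 1) / 2 - 1) := by rw [← pow_add, e1]
  have key : ∀ x y : ℚ, (Nn : ℚ) * (x * ((Wn : ℕ) : ℚ)⁻¹ * y) = (Nat.card 𝓀[K] : ℚ) ^ (2 * ρ + 2 * t - (ρ + 2 * t + 1) / 2) * (x * y) := fun x y => by
    rw [show (Nn : ℚ) * (x * ((Wn : ℕ) : ℚ)⁻¹ * y) = (Nn : ℚ) * ((Wn : ℕ) : ℚ)⁻¹ * (x * y) by ring, hmass]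
  fin_cases i
  · -- slot 0: the twisted sum vanishes (or the indicator is off)
    simp only [Fin.zero_eta, Fin.isValue, Matrix.cons_val_zero]
    by_cases hP : 2 * d - 1 ≤ ρ
    · rw [sum_normSign_mul_normSign_one_add_mul_normSign_one_add_div_eq_zero hD h2 (by omega) ht (by omega : 1 ≤ k₃ - ρ - t) hfin.toFinset hR1' hR2' hR3'
        hσκ'' hκ''v]
      simp only [Int.cast_zero, mul_zero]
    · rw [if_neg hP]
      simp only [mul_zero, zero_div, zero_mul]
  · -- slot 1: the same with `Σ ω(g)ω(1+κ″∕g)`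
    simp only [Fin.mk_one, Fin.isValue, Matrix.cons_val_one, Matrix.cons_val_zero]
    by_cases hP : 2 * d - 1 ≤ ρ
    · rw [sum_normSign_mul_normSign_one_add_div_eq_zero hD h2 (by omega) (by omega : 1 ≤ k₃ - ρ - t) hfin.toFinset hR1' hR2' hR3' hσκ'' hκ''v]
      simp only [Int.cast_zero, mul_zero]
    · rw [if_neg hP]
      simp only [mul_zero, zero_div, zero_mul]
  · -- slot 2: the three regimes of `t′ = k₃ − ρ − t` against `d`
    simp only [Fin.reduceFinMk, Matrix.cons_val_two, Matrix.tail_cons, Matrix.head_cons]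
    rcases lt_trichotomy (k₃ - ρ - t + 1) d with hc | hc | hc
    · -- `t′ + 2 ≤ d`: the window sum vanishes, or the indicator is off
      rw [if_neg (by omega : ¬ d ≤ k₃ - ρ - t), if_neg (by omega : ¬ (k₃ - ρ - t + 1 = d))]
      by_cases hJ : 2 * d ≤ ρ + 2 * (k₃ - ρ - t) + 1
      · rw [sum_normSign_one_add_div_eq_zero hD h2 (by omega : 1 ≤ k₃ - ρ - t) (by omega) hJ hfin.toFinset hR1' hR2' hR3' hσκ'' hκ''v]
        simp only [Int.cast_zero, mul_zero, sub_self]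
      · rw [if_neg hJ]
        simp only [mul_zero, zero_div, zero_mul, sub_self]
    · -- `t′ + 1 = d`: the boundary
      rw [if_neg (by omega : ¬ d ≤ k₃ - ρ - t), if_pos hc, if_pos (by omega : 2 * d ≤ ρ + 2 * (k₃ - ρ - t) + 1),
        sum_normSign_one_add_div_boundary hD h2 hρ (by omega : 1 ≤ k₃ - ρ - t) hc hfin.toFinset hR1' hR2' hR3' hσκ'' hκ''v, hω1 (by omega), key, epow]
      push_cast
      ring
    · -- `d ≤ t′`: everything is a norm
      rw [if_pos (by omega : d ≤ k₃ - ρ - t), if_neg (by omega : ¬ (k₃ - ρ - t + 1 = d)), if_pos (by omega : 2 * d ≤ ρ + 2 * (k₃ - ρ - t) + 1),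
        sum_normSign_one_add_div_eq_card hD (by omega : 2 * d - 1 ≤ 2 * (k₃ - ρ - t)) hfin.toFinset hR1' hσκ'' hκ''v, hω1 (by omega), key, epow, hRcard]
      push_cast [Nat.cast_sub hq1.le]
      ring

end Summit.HodgeConjecture.HodgeConjecture.Cruxes.H413.F0P3cDyRamLabelledOddKappaClassSumG3

end
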